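import Summits.ResolutionOfSingularities.ResolutionOfSingularities.Theorems.FrobeniusClosingSteerHevLeafMaxDropSplit
import Summits.ResolutionOfSingularities.ResolutionOfSingularities.Theorems.FrobeniusClosingSteerSteeredExit
import HarnessLib

/-!
# (MAX-ND)ᴵ RECUT — TORIC / CLUSTER split keyed on ONE proposition `ToricUnitExit.HasUnitDominantOddStage O A₀ t`
  (res-L0-w41-tri-1 g7, words of record per res-L0-w41-plan-1 RULING 262 (a); folded by res-L0-w41-tri-3 `RECUT-MAXND.md`; SIGNATURES + PROVED glue; 0 sorries)

After `MaxVacuity.shadowConclInd_holds`, `HevLeaf.DropSplit.maxDrop_holds` and the (MAX)ᴵ drop-split, the EVEN frontier of the hEv leaf is (MAX-ND)ᴵ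
`HevLeaf.DropSplit.StrippingTailSwitchingEvenInfMaxNoDropConclIndTwoN` ALONE. This file cuts it once more, on whether the datum `(O, A₀, t)` admits a
UNIT-DOMINANT ODD STAGE: SOME finite tower of local blowings up along `O` from the start member `locAtCentre A₀ O` (`s 0 = t`, steps `s i = x·s (i+1) + g`)
ending at a regular local stage `R N ⊆ O` centred by `O`, with a regular system of parameters `y`, where `s N ² = g² + w·y^M + Σ aᵢ·y^{Eᵢ}`, `w` a UNIT of
`R N`, `M` with an ODD entry, and every tail monomial `y^{Eᵢ}` TERMWISE `ν`-dominated by `y^M` (= the hypothesis block of res-L0-w41-strat-1ʼs K-TX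
`ToricUnitExit.concl_of_unit_dominant_monomial`, ∃-closed).

* `ToricUnitExit.HasUnitDominantOddStage O A₀ t` — the proposition.
* (MAX-TX)ᴵ `StrippingTailSwitchingEvenInfMaxNoDropToricConclTwoN` — a unit-dominant odd stage closes the datum (a RING statement: the run binders of
  (MAX-ND)ᴵ are decoration here and are dropped). It is K-TX read as one proposition: `ToricUnitExit.UnitDominantMonomialConclTwo` (K-TXʼs signature,
  binder for binder) ⟹ (MAX-TX)ᴵ, PROVED (`…Toric_of_unitDominantMonomialConcl`). Inhabitants of record (W10⁺, W8⁺, W10/W14e, the N-family start) all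
  have such a stage at `N = 0`.
* (MAX-CL∞)ᴵ `StrippingTailSwitchingEvenInfMaxNoDropClusterConclIndTwoN` — (MAX-ND)ᴵ VERBATIM with ONE extra hypothesis `¬ HasUnitDominantOddStage O A₀ t`
  («the run never reaches a unit-dominant odd stage»: the cluster is not cut through). THE RESIDUAL: no inhabitant of record, nothing discharged, kill
  shape = failure of local uniformization for the datum.
* GLUE (PROVED, excluded middle): (MAX-ND)ᴵ ⟸ (MAX-TX)ᴵ ∧ (MAX-CL∞)ᴵ.

OURS (campaign res-hironaka, rung L ★L-G4, slot W4.1, crux `Steer` stmt-ResolutionOfSingularities-16345); candidates, not facts; replaces the role of no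
printed item; NOT a statement of the manuscript under review [claim: Hironaka2017, status: under-review]; AI review is weaker than expert review.
-/

-- `Summit.<S>.<S>.…` duplicates the summit name by design (single-problem summit).
set_option linter.dupNamespace false

noncomputable section

open IsLocalRing
open scoped BigOperators
open Literature.AlgebraicGeometry.Resolution
open Summit.ResolutionOfSingularities.ResolutionOfSingularities.Theorems.SwitchingDichotomy.Words
open Summit.ResolutionOfSingularities.ResolutionOfSingularities.Theorems.SteerRankThinness (Concl HasProperCoarsening)
open Summit.ResolutionOfSingularities.ResolutionOfSingularities.Theorems.SwitchingDichotomy.ArithReduction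
open Summit.ResolutionOfSingularities.ResolutionOfSingularities.Theorems.SwitchingDichotomy

namespace Summit.ResolutionOfSingularities.ResolutionOfSingularities.Theorems.SwitchingDichotomy

namespace ToricUnitExit

variable {k K : Type} [Field k] [Field K] [Algebra k K]

/-- **`HasUnitDominantOddStage O A₀ t`**: SOME finite tower of local blowings up along `O`, starting at the START member `locAtCentre A₀ O` with torsor
generator `s 0 = t` and steps `s i = x · s (i+1) + g`, ends at a regular local stage `R N ⊆ O` centred by `O` (`a ∈ 𝔪 ↔ ν(a) > 0`), with a regular
system of parameters `y` (`span (range y) = 𝔪`, `dim = n`), where the radicand reads `s N ² = g² + w·y^M + Σ aᵢ·y^{Eᵢ}` with `w` a UNIT of `R N` (not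
merely of `O`), `M` having an ODD entry, and EVERY tail monomial `y^{Eᵢ}` TERMWISE `ν`-dominated by `y^M` — the clause
`O.valuation (y^{Eᵢ}) < O.valuation (y^M)` (multiplicative valuation: `<` = higher value). (= the hypothesis block of K-TX, ∃-closed from the start.)
OURS. (folklore) -/
def HasUnitDominantOddStage (O : ValuationSubring K) (A₀ : Subalgebra k K) (t : K) : Prop :=
  ∃ (R : ℕ → Subring K) (s : ℕ → K) (N : ℕ), R 0 = locAtCentre A₀.toSubring O ∧ s 0 = t ∧
    (∀ i < N, IsLocalBlowup O (R i) (R (i + 1)) ∧ ∃ x g : K, x ∈ R i ∧ g ∈ R i ∧ s i = x * s (i + 1) + g) ∧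
    ∃ (_ : IsLocalRing (R N)) (_ : IsRegularLocalRing (R N)), R N ≤ O.toSubring ∧
      (∀ a : R N, a ∈ maximalIdeal (R N) ↔ O.valuation (a : K) < 1) ∧
      ∃ (n m : ℕ) (y : Fin n → R N), Ideal.span (Set.range y) = maximalIdeal (R N) ∧ ringKrullDim (R N) = n ∧
        ∃ (g w : R N) (a : Fin m → R N) (M : Fin n → ℕ) (E : Fin m → Fin n → ℕ), IsUnit w ∧ (∃ j, Odd (M j)) ∧
          s N ^ 2 = (g : K) ^ 2 + (w : K) * ∏ j, (y j : K) ^ M j + ∑ i, (a i : K) * ∏ j, (y j : K) ^ E i j ∧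
          ∀ i, O.valuation (∏ j, (y j : K) ^ E i j) < O.valuation (∏ j, (y j : K) ^ M j)

/-- **K-TX as ONE proposition** — the signature of res-L0-w41-strat-1ʼs `ToricUnitExit.concl_of_unit_dominant_monomial` (skeleton
`KTX_skeleton-strat1-g10.lean` f14dbc5d71d79534 l.88–106), binder for binder; conclusion = `Concl O A₀ t` unfolded. A unit-dominant monomial with an odd
exponent at a member reached by local blowings up closes the datum (Perron pair blow-ups inside the odd support, one characteristic-2 division step, exit
at a linear-unit radicand). OURS. (ref. NovacoskiSpivakovsky2014, Def. 2.8) (folklore) -/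
def UnitDominantMonomialConclTwo : Prop :=
  ∀ (k K : Type) [Field k] [Field K] [Algebra k K] [CharP K 2] (O : ValuationSubring K) (A₀ : Subalgebra k K)
    (h₀ : A₀.toSubring ≤ O.toSubring) (t : K), A₀.FG →
    IsFractionRing (Algebra.adjoin k (insert t (A₀ : Set K))) K →
    ∀ (R : ℕ → Subring K), R 0 = locAtCentre A₀.toSubring O →
    ∀ (s : ℕ → K) (N : ℕ), s 0 = t →
    (∀ i < N, IsLocalBlowup O (R i) (R (i + 1)) ∧
      ∃ x g : K, x ∈ R i ∧ g ∈ R i ∧ s i = x * s (i + 1) + g) →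
    ∀ (_ : IsLocalRing (R N)) (_ : IsRegularLocalRing (R N)),
    R N ≤ O.toSubring → (∀ a : R N, a ∈ maximalIdeal (R N) ↔ O.valuation (a : K) < 1) →
    ∀ {n m : ℕ} (y : Fin n → R N), Ideal.span (Set.range y) = maximalIdeal (R N) →
    ringKrullDim (R N) = n →
    ∀ (g w : R N), IsUnit w → ∀ (a : Fin m → R N)
    (M : Fin n → ℕ), (∃ j, Odd (M j)) → ∀ (E : Fin m → Fin n → ℕ),
    s N ^ 2 = (g : K) ^ 2 + (w : K) * ∏ j, (y j : K) ^ M j +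
      ∑ i, (a i : K) * ∏ j, (y j : K) ^ E i j →
    (∀ i, O.valuation (∏ j, (y j : K) ^ E i j) < O.valuation (∏ j, (y j : K) ^ M j)) →
    ∃ (A : Subalgebra k K) (h : A.toSubring ≤ O.toSubring), A₀ ≤ A ∧ t ∈ A ∧ A.FG ∧
      IsFractionRing A K ∧ IsRegularLocalRing (Localization.AtPrime
        (Ideal.comap (Subring.inclusion h) (IsLocalRing.maximalIdeal O)))

end ToricUnitExit

namespace HevLeaf

namespace DropSplit

variable {k K : Type} [Field k] [Field K] [Algebra k K]

/-- **(MAX-TX)ᴵ `StrippingTailSwitchingEvenInfMaxNoDropToricConclTwoN`** — the TORIC half of the recut: a unit-dominant odd stage closes the datum.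
A ring statement (the run binders of (MAX-ND)ᴵ are decoration here and are dropped). OURS. (folklore) -/
def StrippingTailSwitchingEvenInfMaxNoDropToricConclTwoN : Prop :=
  ∀ (k K : Type) [Field k] [CharP k 2] [Field K] [Algebra k K]
    (O : ValuationSubring K) (A₀ : Subalgebra k K) (h₀ : A₀.toSubring ≤ O.toSubring) (t : K),
    A₀.FG → IsFractionRing (Algebra.adjoin k (insert t (A₀ : Set K))) K →
    ToricUnitExit.HasUnitDominantOddStage O A₀ t → Concl O A₀ t

/-- (MAX-TX)ᴵ ⟸ K-TX (pure unpacking; `CharP K 2` from `CharP k 2` along `algebraMap k K`). PROVED. OURS. [folklore] -/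
theorem strippingTailSwitchingEvenInfMaxNoDropToric_of_unitDominantMonomialConcl (hK : ToricUnitExit.UnitDominantMonomialConclTwo) :
    StrippingTailSwitchingEvenInfMaxNoDropToricConclTwoN := by
  intro k K _ _ _ _ O A₀ h₀ t hfg hfr hH
  haveI : CharP K 2 := charP_of_injective_algebraMap (algebraMap k K).injective 2
  obtain ⟨R, s, N, hR0, hs0, hstep, hloc, hreg, hRO, hcen, n, m, y, hy, hn, g, w, a, M, E, hw, hodd, heq, hdom⟩ := hH
  exact hK k K O A₀ h₀ t hfg hfr R hR0 s N hs0 hstep hloc hreg hRO hcen y hy hn g w hw a M hodd E heq hdom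

/-- **(MAX-CL∞)ᴵ `StrippingTailSwitchingEvenInfMaxNoDropClusterConclIndTwoN`** — `StrippingTailSwitchingEvenInfMaxNoDropConclIndTwoN` VERBATIM with ONE
extra hypothesis `¬ ToricUnitExit.HasUnitDominantOddStage O A₀ t` (inserted before the inductive binder): the run NEVER reaches a unit-dominant odd stage.
THE RESIDUAL of the even side; no inhabitant of record; nothing discharged; kill shape = failure of local uniformization for `(O, A₀, t)`.
OURS. (folklore) -/
def StrippingTailSwitchingEvenInfMaxNoDropClusterConclIndTwoN : Prop :=
  ∀ p : ℕ, p = 2 →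
    ∀ (k K : Type) [Field k] [CharP k p] [PerfectField k] [Field K] [Algebra k K]
    (O : ValuationSubring K) (A₀ : Subalgebra k K) (h₀ : A₀.toSubring ≤ O.toSubring) (t : K),
    CoreDatum p 4 k K O A₀ h₀ t → ¬ HasProperCoarsening O →
    ∀ (R : ℕ → Subring K) (P : (i : ℕ) → Ideal (R i)) (s : ℕ → K),
      R 0 = locAtCentre A₀.toSubring O → NormalAt O (R 0) p t → IsSteeredRun O R P t p s →
      (¬ ∃ i₀ c : ℕ, 1 ≤ c ∧ IsDominantTail R P i₀ c) →
      (∃ i₀ : ℕ, ∀ i, i₀ ≤ i → IsHighOrderAt R s p i) →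
      ¬ HeightTwoStepsInfinite R P → {j | IsPosStep R P j}.Infinite →
      (∀ i₀ : ℕ, ∃ i, i₀ ≤ i ∧ IsPointStep R P i ∧
        ∀ hs : s i ^ p ∈ R i, ¬ HasIsolatedSingularity (RadicandRing (R i) p ⟨s i ^ p, hs⟩)) →
      (¬ ∃ i₀ : ℕ, ∃ x : K, x ≠ 0 ∧ x ∈ O ∧ O.valuation x < 1 ∧
        ∀ i, i₀ ≤ i → ∀ y ∈ R i, O.valuation y < 1 → ∃ j, i < j ∧ y / x ∈ R j) →
      (∃ i₀ : ℕ, ∀ i, i₀ ≤ i → ¬ OddCleanedPointStepAt R P s p i) →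
      (∃ i₀ e : ℕ, 2 ≤ e ∧ (∀ i, i₀ ≤ i → IsPointStep R P i → BinaryResiduePointStepAt R P s p (2 * e) i) ∧
        ¬ OrderInduction.CleanerReaches p O A₀.toSubring t (2 * e + 1)) →
      (∀ i₀ : ℕ, ∃ i i' : ℕ, i₀ ≤ i ∧ IsSatellitePair R P i i') →
      (∃ i₀ : ℕ, ∀ i i' : ℕ, i₀ ≤ i → IsSatellitePair R P i i' → ¬ NoSingularSurfaceAt R s p i') →
      (∃ i₀ : ℕ, ∀ i, i₀ ≤ i → IsPointStep R P i → IsMaxGenAt (R i) p t (s i)) →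
      ¬ ToricUnitExit.HasUnitDominantOddStage O A₀ t →
      OrderInduction.ConclBelowDatum p k K O A₀ t →
      Concl O A₀ t

/-- **GLUE (PROVED, pure logic): (MAX-ND)ᴵ ⟸ (MAX-TX)ᴵ ∧ (MAX-CL∞)ᴵ** — excluded middle on `HasUnitDominantOddStage O A₀ t`; `A₀.FG` and
`IsFractionRing k[A₀][t] K` are the first two fields of `CoreDatum`. OURS. [folklore] -/
theorem strippingTailSwitchingEvenInfMaxNoDropConclIndTwoN_of_toric_of_cluster
    (hTX : StrippingTailSwitchingEvenInfMaxNoDropToricConclTwoN)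
    (hCL : StrippingTailSwitchingEvenInfMaxNoDropClusterConclIndTwoN) :
    StrippingTailSwitchingEvenInfMaxNoDropConclIndTwoN := by
  intro p hp2 k K _ _ _ _ _ O A₀ h₀ t core hrk R P s hR0 hN hrun hnd hhigh h2 hinf hwild hsw hev hbin hsat hsing hmax hbelow
  by_cases hH : ToricUnitExit.HasUnitDominantOddStage O A₀ t
  · subst hp2
    obtain ⟨hfg, htp, hfr, -⟩ := core
    exact hTX k K O A₀ h₀ t hfg hfr hH
  · exact hCL p hp2 k K O A₀ h₀ t core hrk R P s hR0 hN hrun hnd hhigh h2 hinf hwild hsw hev hbin hsat hsing hmax hH hbelow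

end DropSplit

end HevLeaf

end Summit.ResolutionOfSingularities.ResolutionOfSingularities.Theorems.SwitchingDichotomy

end
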